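import Literature.NumberTheory.EllipticCurves.CuspFormTwistRatPlusSymbolOdd
import Literature.NumberTheory.EllipticCurves.CuspFormTwistRatPlusSymbol
import HarnessLib

/-!
# The rational MINUS symbol of a quadratic twist: `[r]⁻_{f_χ} = c · ∑_{u mod m} χ(u) [r + u/m]^∓_f` with ONE constant `c`
# (Mazur–Tate–Teitelbaum 1986, §I.8; Shimura 1971, Prop. 3.64) — PROOFS ONLY

Minus twin of `CuspFormTwistRatPlusSymbol` (even `χ`: `[r]⁺_{f_χ}` on `[·]⁺_f`) and `CuspFormTwistRatPlusSymbolOdd` (odd `χ`: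
`[r]⁺_{f_χ}` on `[·]⁻_f`). For RATIONAL NEWFORMS `f` and `F = f_χ = charTwist L hN hm hχ f` and a primitive quadratic `χ` mod `m`,
the complex identities `minusSymbol f_χ r = g(χ)⁻¹ ∑_u χ(u) minusSymbol f (r + u/m)` (even `χ`, `minusSymbol_charTwist_of_even`) and
`minusSymbol f_χ r = g(χ)⁻¹ ∑_u χ(u) plusSymbol f (r + u/m)` (odd `χ`, `minusSymbol_charTwist_of_odd`), together with
`[r]⁻ · Ω⁻ · i = minusSymbol` (`ratMinusSymbol_mul_minusPeriod_mul_I`, Manin–Drinfeld) and `[r]⁺ · Ω⁺ = plusSymbol`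
(`ratCast_ratPlusSymbol_mul_plusPeriod`), give:

* `ratMinusSymbol_charTwist_mul_minusPeriod_mul_gaussSum` (even): `[r]⁻_F · Ω⁻_F · g(χ) = Ω⁻_f · ∑_u χ(u) [r + u/m]⁻_f`;
* `exists_rat_forall_ratMinusSymbol_charTwist_eq` (even): ONE `c ∈ ℚ` with `[r]⁻_F = c · ∑_u ε(u)[r + u/m]⁻_f` for all `r`, and
  `c · Ω⁻_F · g(χ) = Ω⁻_f` as soon as one twisted sum is non-zero;
* `ratMinusSymbol_charTwist_mul_minusPeriod_mul_I_mul_gaussSum_of_odd` (odd): `[r]⁻_F · Ω⁻_F · i · g(χ) = Ω⁺_f · ∑_u χ(u) [r + u/m]⁺_f`;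
* `exists_rat_forall_ratMinusSymbol_charTwist_eq_of_odd` (odd): ONE `c ∈ ℚ` with `[r]⁻_F = c · ∑_u ε(u)[r + u/m]⁺_f`, and
  `c · Ω⁻_F · i · g(χ) = Ω⁺_f` as soon as one twisted sum is non-zero.

These are the symbol-level inputs of the Birch transport of the MINUS (odd-branch) `p`-adic `L`-function of a quadratic twist
(crux stmt-BirchSwinnertonDyer-20368, road (C), memo `Cruxes/SplitBadTwoRankOneOfFacts/PERIOD-CANCELS-w8g24.md` §6, gap T⁻⁻ (i)).
Everything is proved; no named fact, no definition.

## References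

* B. Mazur, J. Tate, J. Teitelbaum, Invent. Math. 84 (1986), §I.8. [MazurTateTeitelbaum1986Invent]
* G. Shimura, *Introduction to the arithmetic theory of automorphic functions* (1971), Prop. 3.64. [Shimura1971]
-/

noncomputable section

open scoped MatrixGroups ModularForm Real

open CongruenceSubgroup UpperHalfPlane Complex

namespace Literature.NumberTheory.EllipticCurves.ModularForms

section RatTwistMinus

variable {N : ℕ} [NeZero N] {m : ℕ} [NeZero m] (L : ℕ) [NeZero L]

/-- **The rational minus symbol of the twist, EVEN primitive quadratic `χ`**:
`[r]⁻_{f_χ} · Ω⁻_{f_χ} · g(χ) = Ω⁻_f · ∑_{u mod m} χ(u) [r + u/m]⁻_f` in `ℂ`, for rational newforms `f` and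
`f_χ = charTwist L hN hm hχ f` (`minusSymbol_charTwist_of_even`, `ratMinusSymbol_mul_minusPeriod_mul_I` on both sides, `i ≠ 0`).
[cite: MazurTateTeitelbaum1986Invent, §I.8] [cite: Shimura1971, Prop. 3.64] -/
theorem ratMinusSymbol_charTwist_mul_minusPeriod_mul_gaussSum (hN : N ∣ L) (hm : m ^ 2 ∣ L)
    {χ : DirichletCharacter ℂ m} (hχ : χ.IsQuadratic) (hχe : χ.Even) (hχp : χ.IsPrimitive)
    {f : CuspForm (Gamma0 N) 2} (hf : IsNewform0 f) (hQ : coeffField f = ⊥)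
    (hF : IsNewform0 (charTwist L hN hm hχ f)) (hQF : coeffField (charTwist L hN hm hχ f) = ⊥)
    (r : ℚ) :
    ((ratMinusSymbol (charTwist L hN hm hχ f) r : ℚ) : ℂ) * (minusPeriod (charTwist L hN hm hχ f) : ℂ) *
        gaussSum χ (ZMod.stdAddChar (N := m)) =
      (minusPeriod f : ℂ) * ∑ u : ZMod m, χ u * ((ratMinusSymbol f (r + twistShift u) : ℚ) : ℂ) := by
  have hg : gaussSum χ (ZMod.stdAddChar (N := m)) ≠ 0 := gaussSum_stdAddChar_ne_zero_of_isPrimitive hχp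
  have hF' := ratMinusSymbol_mul_minusPeriod_mul_I (charTwist L hN hm hχ f) hF hQF r
  rw [minusSymbol_charTwist_of_even L hN hm hχ hχe f r] at hF'
  have hterm : ∀ u : ZMod m, χ u * minusSymbol f (r + twistShift u) =
      (minusPeriod f : ℂ) * Complex.I * (χ u * ((ratMinusSymbol f (r + twistShift u) : ℚ) : ℂ)) := fun u ↦ by
    rw [← ratMinusSymbol_mul_minusPeriod_mul_I f hf hQ]
    ring
  have hR : ∑ u : ZMod m, χ u * minusSymbol f (r + twistShift u) =
      (minusPeriod f : ℂ) * Complex.I *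
        ∑ u : ZMod m, χ u * ((ratMinusSymbol f (r + twistShift u) : ℚ) : ℂ) := by
    rw [Finset.mul_sum]
    exact Finset.sum_congr rfl fun u _ ↦ hterm u
  rw [hR] at hF'
  -- `A·i = g⁻¹ (Ω⁻_f i S)` ⇒ `A g = Ω⁻_f S` (cancel `i`)
  apply mul_right_cancel₀ Complex.I_ne_zero
  have h2 : ((ratMinusSymbol (charTwist L hN hm hχ f) r : ℚ) : ℂ) * (minusPeriod (charTwist L hN hm hχ f) : ℂ) *
      gaussSum χ (ZMod.stdAddChar (N := m)) * Complex.I =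
      (((ratMinusSymbol (charTwist L hN hm hχ f) r : ℚ) : ℂ) * (minusPeriod (charTwist L hN hm hχ f) : ℂ) *
        Complex.I) * gaussSum χ (ZMod.stdAddChar (N := m)) := by ring
  rw [h2, hF']
  field_simp

/-- **ONE rational constant (even `χ`, minus symbols)**: for rational newforms `f`, `f_χ` and an even primitive quadratic
`χ = ε` (integer-valued), there is `c ∈ ℚ` with `[r]⁻_{f_χ} = c · ∑_{u mod m} ε(u) [r + u/m]⁻_f` for EVERY `r ∈ ℚ`, and
`c · Ω⁻_{f_χ} · g(χ) = Ω⁻_f` as soon as one twisted sum is non-zero.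
[cite: MazurTateTeitelbaum1986Invent, §I.8] [cite: Shimura1971, Prop. 3.64] -/
theorem exists_rat_forall_ratMinusSymbol_charTwist_eq (hN : N ∣ L) (hm : m ^ 2 ∣ L)
    {χ : DirichletCharacter ℂ m} (hχ : χ.IsQuadratic) (hχe : χ.Even) (hχp : χ.IsPrimitive)
    {f : CuspForm (Gamma0 N) 2} (hf : IsNewform0 f) (hQ : coeffField f = ⊥)
    (hF : IsNewform0 (charTwist L hN hm hχ f)) (hQF : coeffField (charTwist L hN hm hχ f) = ⊥)
    (ε : ZMod m → ℤ) (hε : ∀ u, χ u = (ε u : ℂ)) :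
    ∃ c : ℚ, (∀ r : ℚ, ratMinusSymbol (charTwist L hN hm hχ f) r =
        c * ∑ u : ZMod m, (ε u : ℚ) * ratMinusSymbol f (r + twistShift u)) ∧
      ((∃ r : ℚ, ∑ u : ZMod m, (ε u : ℚ) * ratMinusSymbol f (r + twistShift u) ≠ 0) →
        (c : ℂ) * (minusPeriod (charTwist L hN hm hχ f) : ℂ) * gaussSum χ (ZMod.stdAddChar (N := m)) =
          (minusPeriod f : ℂ)) := by
  set F := charTwist L hN hm hχ f with hFdef
  set S : ℚ → ℚ := fun r ↦ ∑ u : ZMod m, (ε u : ℚ) * ratMinusSymbol f (r + twistShift u) with hSdef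
  have hg : gaussSum χ (ZMod.stdAddChar (N := m)) ≠ 0 := gaussSum_stdAddChar_ne_zero_of_isPrimitive hχp
  have hΩF : (minusPeriod F : ℂ) ≠ 0 := by exact_mod_cast (IsNewform0.minusPeriod_pos_holds hF hQF).ne'
  have key : ∀ r : ℚ, ((ratMinusSymbol F r : ℚ) : ℂ) * (minusPeriod F : ℂ) *
      gaussSum χ (ZMod.stdAddChar (N := m)) = (minusPeriod f : ℂ) * ((S r : ℚ) : ℂ) := by
    intro r
    rw [ratMinusSymbol_charTwist_mul_minusPeriod_mul_gaussSum L hN hm hχ hχe hχp hf hQ hF hQF r, hSdef]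
    push_cast
    congr 1
    exact Finset.sum_congr rfl fun u _ ↦ by rw [hε u]
  by_cases hex : ∃ r₀ : ℚ, S r₀ ≠ 0
  · obtain ⟨r₀, hr₀⟩ := hex
    refine ⟨ratMinusSymbol F r₀ / S r₀, fun r ↦ ?_, fun _ ↦ ?_⟩
    · have h1 := key r
      have h0 := key r₀
      have hS0 : ((S r₀ : ℚ) : ℂ) ≠ 0 := by exact_mod_cast hr₀
      have hK : (minusPeriod F : ℂ) * gaussSum χ (ZMod.stdAddChar (N := m)) ≠ 0 := mul_ne_zero hΩF hg
      have hC : ((ratMinusSymbol F r : ℚ) : ℂ) =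
          ((ratMinusSymbol F r₀ : ℚ) : ℂ) / ((S r₀ : ℚ) : ℂ) * ((S r : ℚ) : ℂ) := by
        apply mul_right_cancel₀ hK
        rw [div_mul_eq_mul_div, div_mul_eq_mul_div, eq_div_iff hS0]
        linear_combination (((S r₀ : ℚ) : ℂ)) * h1 - (((S r : ℚ) : ℂ)) * h0
      change ratMinusSymbol F r = ratMinusSymbol F r₀ / S r₀ * S r
      exact_mod_cast hC
    · have h0 := key r₀
      have hS0 : ((S r₀ : ℚ) : ℂ) ≠ 0 := by exact_mod_cast hr₀
      push_cast
      rw [div_mul_eq_mul_div, div_mul_eq_mul_div, div_eq_iff hS0]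
      linear_combination h0
  · simp only [not_exists, not_not] at hex
    refine ⟨0, fun r ↦ ?_, fun ⟨r₀, hr₀⟩ ↦ absurd (hex r₀) hr₀⟩
    have h1 := key r
    rw [hex r, Rat.cast_zero, mul_zero] at h1
    have : ((ratMinusSymbol F r : ℚ) : ℂ) = 0 := by
      rcases mul_eq_zero.mp h1 with h | h
      · rcases mul_eq_zero.mp h with h' | h'
        · exact h'
        · exact absurd h' hΩF
      · exact absurd h hg
    have hz : ratMinusSymbol F r = 0 := by exact_mod_cast this
    rw [hz, zero_mul]

/-- **The rational minus symbol of the twist, ODD primitive quadratic `χ`**: plus and minus are exchanged,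
`[r]⁻_{f_χ} · Ω⁻_{f_χ} · i · g(χ) = Ω⁺_f · ∑_{u mod m} χ(u) [r + u/m]⁺_f` in `ℂ` (`minusSymbol_charTwist_of_odd`,
`ratMinusSymbol_mul_minusPeriod_mul_I`, `ratCast_ratPlusSymbol_mul_plusPeriod`).
[cite: MazurTateTeitelbaum1986Invent, §I.8] [cite: Shimura1971, Prop. 3.64] -/
theorem ratMinusSymbol_charTwist_mul_minusPeriod_mul_I_mul_gaussSum_of_odd (hN : N ∣ L) (hm : m ^ 2 ∣ L)
    {χ : DirichletCharacter ℂ m} (hχ : χ.IsQuadratic) (hχo : χ.Odd) (hχp : χ.IsPrimitive)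
    {f : CuspForm (Gamma0 N) 2} (hf : IsNewform0 f) (hQ : coeffField f = ⊥)
    (hF : IsNewform0 (charTwist L hN hm hχ f)) (hQF : coeffField (charTwist L hN hm hχ f) = ⊥)
    (r : ℚ) :
    ((ratMinusSymbol (charTwist L hN hm hχ f) r : ℚ) : ℂ) * (minusPeriod (charTwist L hN hm hχ f) : ℂ) *
        Complex.I * gaussSum χ (ZMod.stdAddChar (N := m)) =
      (plusPeriod f : ℂ) * ∑ u : ZMod m, χ u * ((ratPlusSymbol f (r + twistShift u) : ℚ) : ℂ) := by
  have hg : gaussSum χ (ZMod.stdAddChar (N := m)) ≠ 0 := gaussSum_stdAddChar_ne_zero_of_isPrimitive hχp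
  rw [ratMinusSymbol_mul_minusPeriod_mul_I (charTwist L hN hm hχ f) hF hQF r,
    minusSymbol_charTwist_of_odd L hN hm hχ hχo f r]
  have hterm : ∀ u : ZMod m, (plusPeriod f : ℂ) * (χ u * ((ratPlusSymbol f (r + twistShift u) : ℚ) : ℂ)) =
      χ u * plusSymbol f (r + twistShift u) := fun u ↦ by
    rw [← ratCast_ratPlusSymbol_mul_plusPeriod f hf hQ]
    ring
  have hR : (plusPeriod f : ℂ) * ∑ u : ZMod m, χ u * ((ratPlusSymbol f (r + twistShift u) : ℚ) : ℂ) =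
      ∑ u : ZMod m, χ u * plusSymbol f (r + twistShift u) := by
    rw [Finset.mul_sum]
    exact Finset.sum_congr rfl fun u _ ↦ hterm u
  rw [hR, mul_comm, ← mul_assoc, mul_inv_cancel₀ hg, one_mul]

/-- **ONE rational constant (odd `χ`, minus symbols of the twist on plus symbols of `f`)**: for rational newforms `f`, `f_χ` and
an odd primitive quadratic `χ = ε` (integer-valued), there is `c ∈ ℚ` with `[r]⁻_{f_χ} = c · ∑_{u mod m} ε(u) [r + u/m]⁺_f` for
EVERY `r ∈ ℚ`, and `c · Ω⁻_{f_χ} · i · g(χ) = Ω⁺_f` as soon as one twisted sum is non-zero.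
[cite: MazurTateTeitelbaum1986Invent, §I.8] [cite: Shimura1971, Prop. 3.64] -/
theorem exists_rat_forall_ratMinusSymbol_charTwist_eq_of_odd (hN : N ∣ L) (hm : m ^ 2 ∣ L)
    {χ : DirichletCharacter ℂ m} (hχ : χ.IsQuadratic) (hχo : χ.Odd) (hχp : χ.IsPrimitive)
    {f : CuspForm (Gamma0 N) 2} (hf : IsNewform0 f) (hQ : coeffField f = ⊥)
    (hF : IsNewform0 (charTwist L hN hm hχ f)) (hQF : coeffField (charTwist L hN hm hχ f) = ⊥)
    (ε : ZMod m → ℤ) (hε : ∀ u, χ u = (ε u : ℂ)) :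
    ∃ c : ℚ, (∀ r : ℚ, ratMinusSymbol (charTwist L hN hm hχ f) r =
        c * ∑ u : ZMod m, (ε u : ℚ) * ratPlusSymbol f (r + twistShift u)) ∧
      ((∃ r : ℚ, ∑ u : ZMod m, (ε u : ℚ) * ratPlusSymbol f (r + twistShift u) ≠ 0) →
        (c : ℂ) * (minusPeriod (charTwist L hN hm hχ f) : ℂ) * Complex.I * gaussSum χ (ZMod.stdAddChar (N := m)) =
          (plusPeriod f : ℂ)) := by
  set F := charTwist L hN hm hχ f with hFdef
  set S : ℚ → ℚ := fun r ↦ ∑ u : ZMod m, (ε u : ℚ) * ratPlusSymbol f (r + twistShift u) with hSdef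
  have hg : gaussSum χ (ZMod.stdAddChar (N := m)) ≠ 0 := gaussSum_stdAddChar_ne_zero_of_isPrimitive hχp
  have hΩF : (minusPeriod F : ℂ) ≠ 0 := by exact_mod_cast (IsNewform0.minusPeriod_pos_holds hF hQF).ne'
  have hKI : (minusPeriod F : ℂ) * Complex.I * gaussSum χ (ZMod.stdAddChar (N := m)) ≠ 0 :=
    mul_ne_zero (mul_ne_zero hΩF Complex.I_ne_zero) hg
  have key : ∀ r : ℚ, ((ratMinusSymbol F r : ℚ) : ℂ) * (minusPeriod F : ℂ) * Complex.I *
      gaussSum χ (ZMod.stdAddChar (N := m)) = (plusPeriod f : ℂ) * ((S r : ℚ) : ℂ) := by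
    intro r
    rw [ratMinusSymbol_charTwist_mul_minusPeriod_mul_I_mul_gaussSum_of_odd L hN hm hχ hχo hχp hf hQ hF hQF r, hSdef]
    push_cast
    congr 1
    exact Finset.sum_congr rfl fun u _ ↦ by rw [hε u]
  by_cases hex : ∃ r₀ : ℚ, S r₀ ≠ 0
  · obtain ⟨r₀, hr₀⟩ := hex
    refine ⟨ratMinusSymbol F r₀ / S r₀, fun r ↦ ?_, fun _ ↦ ?_⟩
    · have h1 := key r
      have h0 := key r₀
      have hS0 : ((S r₀ : ℚ) : ℂ) ≠ 0 := by exact_mod_cast hr₀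
      have hC : ((ratMinusSymbol F r : ℚ) : ℂ) =
          ((ratMinusSymbol F r₀ : ℚ) : ℂ) / ((S r₀ : ℚ) : ℂ) * ((S r : ℚ) : ℂ) := by
        apply mul_right_cancel₀ hKI
        rw [div_mul_eq_mul_div, div_mul_eq_mul_div, eq_div_iff hS0]
        linear_combination (((S r₀ : ℚ) : ℂ)) * h1 - (((S r : ℚ) : ℂ)) * h0
      change ratMinusSymbol F r = ratMinusSymbol F r₀ / S r₀ * S r
      exact_mod_cast hC
    · have h0 := key r₀
      have hS0 : ((S r₀ : ℚ) : ℂ) ≠ 0 := by exact_mod_cast hr₀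
      push_cast
      rw [div_mul_eq_mul_div, div_mul_eq_mul_div, div_mul_eq_mul_div, div_eq_iff hS0]
      linear_combination h0
  · simp only [not_exists, not_not] at hex
    refine ⟨0, fun r ↦ ?_, fun ⟨r₀, hr₀⟩ ↦ absurd (hex r₀) hr₀⟩
    have h1 := key r
    rw [hex r, Rat.cast_zero, mul_zero] at h1
    have : ((ratMinusSymbol F r : ℚ) : ℂ) = 0 := by
      rcases mul_eq_zero.mp h1 with h | h
      · rcases mul_eq_zero.mp h with h' | h'
        · rcases mul_eq_zero.mp h' with h'' | h''
          · exact h''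
          · exact absurd h'' hΩF
        · exact absurd h' Complex.I_ne_zero
      · exact absurd h hg
    have hz : ratMinusSymbol F r = 0 := by exact_mod_cast this
    rw [hz, zero_mul]

end RatTwistMinus

end Literature.NumberTheory.EllipticCurves.ModularForms

end
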